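import Summits.MatrixMultiplication.MatrixMultiplication.Theorems.ObstructionCalculusLocality

set_option linter.dupNamespace false
set_option autoImplicit false

/-!
# Obstruction calculus · pointwise saturation: the engines on the MULTIPLICITY side
(decomp-mm · lens 3 · gen 26; route-free support module for `route-MatrixMultiplication-ObstructionDescent`)

`ObstructionCalculusLocality` proves the two SATURATION ENGINES of the unit-tensor orbit closure
`σ_m = closure(GL_m³·⟨m⟩)` in OCCURRENCE form: from `HWV_{Λ,d} ≤ I(σ_m)` conclude `HWV_{Λ,d} = ⊥`
(`hwvSpace_eq_bot_of_card_mul_card_le`, `hwvSpace_eq_bot_of_degree_le`).  Their proofs are pointwise, and this module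
records the POINTWISE (= multiplicity) forms, which the information axis of `ObstructionDescent` needs for its support
`P_M = NoMultiplicityObstruction` (co-multiplicities `coMult t Λ d = dim (HWV_{Λ,d} ⊓ I(GL_m³·t))`):

* §1 ENGINE 1 POINTWISE (few parts in two slots): a weight vector of type `Λ` lying in `I(σ_m)` is zero as soon as
  `ℓ(λ^s)·ℓ(λ^{s'}) ≤ m` for one slot pair — `HWV_{Λ,d} ⊓ I(σ_m) = ⊥`, `coMult ⟨m⟩ Λ d = 0`.
* §2 ENGINE 2 POINTWISE AND TYPE-FREE (prolongation): `I(σ_m)` contains NO non-zero polynomial of total degree `≤ m`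
  (`eq_zero_of_mem_orbitVanishing_unitTensor_of_totalDegree_le`: each monomial involves `≤ m` coordinates and every
  tensor supported on `≤ m` coordinates has rank `≤ m`); hence `HWV_{Λ,d} ⊓ I(σ_m) = ⊥` and `coMult ⟨m⟩ Λ d = 0` for `d ≤ m`.
* §3 MULTIPLICITY-SIDE PAD INHERITANCE: `coMult t Λ d ≤ dim HWV_{Λ,d}` with equality iff `HWV_{Λ,d} ≤ I(GL³·t)`; so a
  type with more than `n²` parts in some slot satisfies `coMult u Λ d ≤ coMult pad_m⟨n,n,n⟩ Λ d` for EVERY tensor `u`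
  (`coMult_le_coMult_padMM_of_lt_card`, from the landed `hwvSpace_le_orbitVanishing_padMM_of_lt_card`).

No definition is introduced; sorry-free; axioms `propext`, `Classical.choice`, `Quot.sound`.  Imports only the route-free
calculus.  [cite: BurgisserIkenmeyer2011, §3.1 (multiplicities in `ℂ[closure(GL³ t)]_d`), Lemma 4.2 (the ideal of `σ_r` vanishes
in degree `≤ r`); Blaser2013, §5]
-/

noncomputable section

open scoped BigOperators

namespace Summit.MatrixMultiplication.MatrixMultiplication.Theorems.ObstructionCalculus

open Literature.Computability.AlgebraicComplexity (triad triad_apply tensorRank unitTensor)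

section PointwiseSaturation

variable {m : ℕ}

/-! ### §1 · Engine 1, pointwise -/

/-- **Engine 1, pointwise slot-pair form.** If the slot pair `s, s'` carries a support→rank bound and the type `Λ` has
`ℓ(λ^s)·ℓ(λ^{s'}) ≤ m`, then every weight vector of type `Λ` vanishing on `GL_m³·⟨m⟩` is zero (by locality it only sees a
block every tensor in which has rank `≤ m`). [this node] -/
theorem eq_zero_of_mem_hwvSpace_of_slotPair {Λ : Fin 3 → Fin m → ℕ} {d : ℕ} (s s' : Fin 3)
    (hrank : ∀ (T T' : Finset (Fin m)) (t : Tensor ℂ m),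
      (∀ a b c, t a b c ≠ 0 → slot s (a, b, c) ∈ T ∧ slot s' (a, b, c) ∈ T') →
        tensorRank t ≤ T.card * T'.card)
    (hcard : (Finset.univ.filter fun a => Λ s a ≠ 0).card *
      (Finset.univ.filter fun a => Λ s' a ≠ 0).card ≤ m)
    {f : MvPolynomial (Idx m) ℂ} (hf : f ∈ hwvSpace Λ d) (hfU : f ∈ orbitVanishing (unitTensor ℂ m)) :
    f = 0 := by
  classical
  obtain ⟨T, hT⟩ : ∃ T : Finset (Fin m), T = Finset.univ.filter fun a => Λ s a ≠ 0 := ⟨_, rfl⟩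
  obtain ⟨T', hT'⟩ : ∃ T' : Finset (Fin m), T' = Finset.univ.filter fun a => Λ s' a ≠ 0 := ⟨_, rfl⟩
  have hTc : ∀ a, a ∉ T → Λ s a = 0 := fun a ha => by
    by_contra h
    exact ha (hT ▸ Finset.mem_filter.2 ⟨Finset.mem_univ a, h⟩)
  have hT'c : ∀ a, a ∉ T' → Λ s' a = 0 := fun a ha => by
    by_contra h
    exact ha (hT' ▸ Finset.mem_filter.2 ⟨Finset.mem_univ a, h⟩)
  apply MvPolynomial.funext
  intro x
  rw [map_zero, eval_eq_evalT, evalT_eq_evalT_proj hf s hTc, evalT_eq_evalT_proj hf s' hT'c]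
  apply evalT_eq_zero_of_tensorRank_le hfU
  refine le_trans (hrank T T' _ fun a b c habc => ⟨?_, ?_⟩) ?_
  · by_contra hs
    exact habc (by simp [proj, hs])
  · by_contra hs'
    exact habc (by simp [proj, hs'])
  · rw [hT, hT']
    exact hcard

/-- Engine 1 pointwise, slots `0,1`: `ℓ(λ⁽⁰⁾)·ℓ(λ⁽¹⁾) ≤ m` ⟹ `HWV_{Λ,d} ⊓ I(σ_m) = ⊥`. [this node] -/
theorem hwvSpace_inf_orbitVanishing_unitTensor_eq_bot_of_card_mul_card_le {Λ : Fin 3 → Fin m → ℕ} {d : ℕ}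
    (hcard : (Finset.univ.filter fun a => Λ 0 a ≠ 0).card *
      (Finset.univ.filter fun a => Λ 1 a ≠ 0).card ≤ m) :
    hwvSpace Λ d ⊓ orbitVanishing (unitTensor ℂ m) = ⊥ :=
  (Submodule.eq_bot_iff _).2 fun _ hf =>
    eq_zero_of_mem_hwvSpace_of_slotPair 0 1
      (fun T T' t h => tensorRank_le_card_mul_card_of_support₀₁ T T' t fun a b c habc => by
        simpa using h a b c habc) hcard hf.1 hf.2

/-- Engine 1 pointwise, slots `0,2`. [this node] -/
theorem hwvSpace_inf_orbitVanishing_unitTensor_eq_bot_of_card_mul_card_le₀₂ {Λ : Fin 3 → Fin m → ℕ} {d : ℕ}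
    (hcard : (Finset.univ.filter fun a => Λ 0 a ≠ 0).card *
      (Finset.univ.filter fun a => Λ 2 a ≠ 0).card ≤ m) :
    hwvSpace Λ d ⊓ orbitVanishing (unitTensor ℂ m) = ⊥ :=
  (Submodule.eq_bot_iff _).2 fun _ hf =>
    eq_zero_of_mem_hwvSpace_of_slotPair 0 2
      (fun T T' t h => tensorRank_le_card_mul_card_of_support₀₂ T T' t fun a b c habc => by
        simpa using h a b c habc) hcard hf.1 hf.2

/-- Engine 1 pointwise, slots `1,2`. [this node] -/
theorem hwvSpace_inf_orbitVanishing_unitTensor_eq_bot_of_card_mul_card_le₁₂ {Λ : Fin 3 → Fin m → ℕ} {d : ℕ}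
    (hcard : (Finset.univ.filter fun a => Λ 1 a ≠ 0).card *
      (Finset.univ.filter fun a => Λ 2 a ≠ 0).card ≤ m) :
    hwvSpace Λ d ⊓ orbitVanishing (unitTensor ℂ m) = ⊥ :=
  (Submodule.eq_bot_iff _).2 fun _ hf =>
    eq_zero_of_mem_hwvSpace_of_slotPair 1 2
      (fun T T' t h => tensorRank_le_card_mul_card_of_support₁₂ T T' t fun a b c habc => by
        simpa using h a b c habc) hcard hf.1 hf.2

/-- `coMult ⟨m⟩ Λ d = 0` when `ℓ(λ⁽⁰⁾)·ℓ(λ⁽¹⁾) ≤ m`: no weight vector of the type vanishes on `σ_m`. [this node] -/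
theorem coMult_unitTensor_eq_zero_of_card_mul_card_le {Λ : Fin 3 → Fin m → ℕ} {d : ℕ}
    (hcard : (Finset.univ.filter fun a => Λ 0 a ≠ 0).card *
      (Finset.univ.filter fun a => Λ 1 a ≠ 0).card ≤ m) : coMult (unitTensor ℂ m) Λ d = 0 := by
  unfold coMult
  rw [hwvSpace_inf_orbitVanishing_unitTensor_eq_bot_of_card_mul_card_le hcard, finrank_bot]

/-- `coMult ⟨m⟩ Λ d = 0` when `ℓ(λ⁽⁰⁾)·ℓ(λ⁽²⁾) ≤ m`. [this node] -/
theorem coMult_unitTensor_eq_zero_of_card_mul_card_le₀₂ {Λ : Fin 3 → Fin m → ℕ} {d : ℕ}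
    (hcard : (Finset.univ.filter fun a => Λ 0 a ≠ 0).card *
      (Finset.univ.filter fun a => Λ 2 a ≠ 0).card ≤ m) : coMult (unitTensor ℂ m) Λ d = 0 := by
  unfold coMult
  rw [hwvSpace_inf_orbitVanishing_unitTensor_eq_bot_of_card_mul_card_le₀₂ hcard, finrank_bot]

/-- `coMult ⟨m⟩ Λ d = 0` when `ℓ(λ⁽¹⁾)·ℓ(λ⁽²⁾) ≤ m`. [this node] -/
theorem coMult_unitTensor_eq_zero_of_card_mul_card_le₁₂ {Λ : Fin 3 → Fin m → ℕ} {d : ℕ}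
    (hcard : (Finset.univ.filter fun a => Λ 1 a ≠ 0).card *
      (Finset.univ.filter fun a => Λ 2 a ≠ 0).card ≤ m) : coMult (unitTensor ℂ m) Λ d = 0 := by
  unfold coMult
  rw [hwvSpace_inf_orbitVanishing_unitTensor_eq_bot_of_card_mul_card_le₁₂ hcard, finrank_bot]

/-! ### §2 · Engine 2, pointwise and type-free: `I(σ_m)` is zero in degree `≤ m` -/

/-- **The ideal of `σ_m` vanishes in degree `≤ m`.** A polynomial of total degree `≤ m` vanishing on `GL_m³·⟨m⟩` is zero:
each of its monomials `μ` involves `≤ m` coordinates, the restriction of `f` to the coordinate subspace `ℂ^{supp μ}` vanishes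
identically (every tensor supported there has rank `≤ |supp μ| ≤ m`), and that restriction has the same `μ`-coefficient as
`f`. [cite: BurgisserIkenmeyer2011, §3.1] -/
theorem eq_zero_of_mem_orbitVanishing_unitTensor_of_totalDegree_le {f : MvPolynomial (Idx m) ℂ}
    (hfU : f ∈ orbitVanishing (unitTensor ℂ m)) (hd : f.totalDegree ≤ m) : f = 0 := by
  classical
  ext μ
  rw [MvPolynomial.coeff_zero]
  by_contra hμ
  -- the monomial `μ` involves at most `deg μ ≤ deg f ≤ m` coordinates
  have hcardμ : μ.support.card ≤ m := by
    have hle : μ.support.card ≤ μ.sum fun _ e => e := by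
      rw [Finsupp.sum, Finset.card_eq_sum_ones]
      exact Finset.sum_le_sum fun i hi => Nat.one_le_iff_ne_zero.2 (Finsupp.mem_support_iff.1 hi)
    exact hle.trans ((MvPolynomial.le_totalDegree (MvPolynomial.mem_support_iff.2 hμ)).trans hd)
  -- the restriction `g` of `f` to the coordinate subspace `ℂ^P`, `P = supp μ`
  obtain ⟨P, hP⟩ : ∃ P : Finset (Idx m), P = μ.support := ⟨_, rfl⟩
  obtain ⟨φ, hφ⟩ : ∃ φ : Idx m → MvPolynomial (Idx m) ℂ,
      φ = fun p => if p ∈ P then MvPolynomial.X p else 0 := ⟨_, rfl⟩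
  -- `g` vanishes identically: its values are values of `f` at tensors of rank `≤ |P| ≤ m`
  have hg0 : MvPolynomial.aeval φ f = 0 := by
    apply MvPolynomial.funext
    intro v
    rw [map_zero, ← MvPolynomial.aeval_eq_eval, MvPolynomial.comp_aeval_apply]
    have hfun : (fun p => MvPolynomial.aeval v (φ p)) = fun p : Idx m =>
        (fun a b c => if (a, b, c) ∈ P then v (a, b, c) else 0) p.1 p.2.1 p.2.2 := by
      funext p
      obtain ⟨a, b, c⟩ := p
      rw [hφ]
      dsimp only
      split_ifs <;> simp
    rw [hfun]
    change evalT (fun a b c => if (a, b, c) ∈ P then v (a, b, c) else 0) f = 0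
    apply evalT_eq_zero_of_tensorRank_le hfU
    refine le_trans ?_ (hP ▸ hcardμ)
    refine tensorRank_le_card_of_eq_finset_sum P (fun p => Pi.single p.1 (v p))
      (fun p => Pi.single p.2.1 1) (fun p => Pi.single p.2.2 1) ?_
    funext a b c
    rw [Finset.sum_apply, Finset.sum_apply, Finset.sum_apply]
    have hterm : ∀ q ∈ P, triad (Pi.single q.1 (v q)) (Pi.single q.2.1 (1 : ℂ))
        (Pi.single q.2.2 (1 : ℂ)) a b c = if (a, b, c) = q then v (a, b, c) else 0 := by
      rintro ⟨i, j, k⟩ _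
      rw [triad_apply, Pi.single_apply, Pi.single_apply, Pi.single_apply]
      by_cases hi : a = i
      · subst hi
        by_cases hj : b = j
        · subst hj
          by_cases hk : c = k
          · subst hk
            simp
          · simp [hk]
        · simp [hj]
      · simp [hi]
    rw [Finset.sum_congr rfl hterm, Finset.sum_ite_eq]
  -- but the `μ`-coefficient of `g` is that of `f`
  have hsum : MvPolynomial.aeval φ f =
      ∑ ν ∈ f.support, MvPolynomial.aeval φ (MvPolynomial.monomial ν (MvPolynomial.coeff ν f)) := by
    conv_lhs => rw [f.as_sum]
    rw [map_sum]
  have hterm : ∀ ν ∈ f.support,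
      MvPolynomial.coeff μ (MvPolynomial.aeval φ (MvPolynomial.monomial ν (MvPolynomial.coeff ν f))) =
        if μ = ν then MvPolynomial.coeff μ f else 0 := by
    intro ν hν
    rw [MvPolynomial.aeval_monomial, MvPolynomial.algebraMap_eq]
    by_cases hsub : ν.support ⊆ P
    · have hprod : (ν.prod fun i k => φ i ^ k) = MvPolynomial.monomial ν (1 : ℂ) := by
        rw [MvPolynomial.monomial_eq, MvPolynomial.C_1, one_mul, Finsupp.prod, Finsupp.prod]
        exact Finset.prod_congr rfl fun i hi => by
          rw [hφ]
          dsimp only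
          rw [if_pos (hsub hi)]
      rw [hprod, MvPolynomial.C_mul_monomial, mul_one, MvPolynomial.coeff_monomial]
      by_cases hμν : ν = μ
      · subst hμν
        simp
      · rw [if_neg hμν, if_neg (Ne.symm hμν)]
    · obtain ⟨i, hiν, hiP⟩ := Finset.not_subset.1 hsub
      have hzero : (ν.prod fun i k => φ i ^ k) = 0 := by
        rw [Finsupp.prod]
        apply Finset.prod_eq_zero hiν
        rw [hφ]
        dsimp only
        rw [if_neg hiP, zero_pow (Finsupp.mem_support_iff.1 hiν)]
      rw [hzero, mul_zero, MvPolynomial.coeff_zero, if_neg]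
      rintro rfl
      exact hiP (hP ▸ hiν)
  have hcoeff : MvPolynomial.coeff μ (MvPolynomial.aeval φ f) = MvPolynomial.coeff μ f := by
    rw [hsum, MvPolynomial.coeff_sum, Finset.sum_congr rfl hterm, Finset.sum_ite_eq,
      if_pos (MvPolynomial.mem_support_iff.2 hμ)]
  rw [hg0, MvPolynomial.coeff_zero] at hcoeff
  exact hμ hcoeff.symm

/-- Engine 2 pointwise: in degree `d ≤ m`, `HWV_{Λ,d} ⊓ I(σ_m) = ⊥` for every type. [this node] -/
theorem hwvSpace_inf_orbitVanishing_unitTensor_eq_bot_of_degree_le {Λ : Fin 3 → Fin m → ℕ} {d : ℕ} (hd : d ≤ m) :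
    hwvSpace Λ d ⊓ orbitVanishing (unitTensor ℂ m) = ⊥ :=
  (Submodule.eq_bot_iff _).2 fun _ hf =>
    eq_zero_of_mem_orbitVanishing_unitTensor_of_totalDegree_le hf.2 (hf.1.1.totalDegree_le.trans hd)

/-- `coMult ⟨m⟩ Λ d = 0` in every degree `d ≤ m`. [this node] -/
theorem coMult_unitTensor_eq_zero_of_degree_le (Λ : Fin 3 → Fin m → ℕ) {d : ℕ} (hd : d ≤ m) :
    coMult (unitTensor ℂ m) Λ d = 0 := by
  unfold coMult
  rw [hwvSpace_inf_orbitVanishing_unitTensor_eq_bot_of_degree_le hd, finrank_bot]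

/-- The occurrence forms of `ObstructionCalculusLocality` are the special case `HWV ≤ I(σ_m)` (sanity link). [bookkeeping] -/
theorem hwvSpace_eq_bot_of_inf_eq_bot {Λ : Fin 3 → Fin m → ℕ} {d : ℕ} {u : Tensor ℂ m}
    (h : hwvSpace Λ d ⊓ orbitVanishing u = ⊥) (hU : hwvSpace Λ d ≤ orbitVanishing u) : hwvSpace Λ d = ⊥ := by
  rwa [inf_eq_left.2 hU] at h

/-! ### §3 · Multiplicity-side pad inheritance -/

/-- `coMult t Λ d ≤ dim HWV_{Λ,d}`. [bookkeeping] -/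
theorem coMult_le_finrank_hwvSpace (t : Tensor ℂ m) (Λ : Fin 3 → Fin m → ℕ) (d : ℕ) :
    coMult t Λ d ≤ Module.finrank ℂ ↥(hwvSpace Λ d) := by
  haveI := finite_hwvSpace (m := m) Λ d
  exact Submodule.finrank_mono inf_le_left

/-- If every weight vector of the type vanishes on `GL³·t` then `coMult t Λ d = dim HWV_{Λ,d}`. [bookkeeping] -/
theorem coMult_eq_finrank_of_le {t : Tensor ℂ m} {Λ : Fin 3 → Fin m → ℕ} {d : ℕ}
    (h : hwvSpace Λ d ≤ orbitVanishing t) : coMult t Λ d = Module.finrank ℂ ↥(hwvSpace Λ d) := by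
  unfold coMult
  rw [inf_eq_left.2 h]

/-- Conversely (finite dimension): `coMult t Λ d = dim HWV_{Λ,d}` forces `HWV_{Λ,d} ≤ I(GL³·t)`. [bookkeeping] -/
theorem le_orbitVanishing_of_finrank_le_coMult {t : Tensor ℂ m} {Λ : Fin 3 → Fin m → ℕ} {d : ℕ}
    (h : Module.finrank ℂ ↥(hwvSpace Λ d) ≤ coMult t Λ d) : hwvSpace Λ d ≤ orbitVanishing t := by
  haveI := finite_hwvSpace (m := m) Λ d
  have heq : hwvSpace Λ d ⊓ orbitVanishing t = hwvSpace Λ d :=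
    Submodule.eq_of_le_of_finrank_le inf_le_left h
  exact (inf_eq_left.1 heq)

/-- **Multiplicity-side pad inheritance**: a type with more than `n²` parts in some slot has
`coMult u Λ d ≤ coMult pad_m⟨n,n,n⟩ Λ d` for every tensor `u` (all its weight vectors vanish on the padded tensor's orbit,
`hwvSpace_le_orbitVanishing_padMM_of_lt_card`). [this node] -/
theorem coMult_le_coMult_padMM_of_lt_card {n : ℕ} (h : n * n ≤ m) (Λ : Fin 3 → Fin m → ℕ) (d : ℕ) {s : Fin 3}
    (hs : n * n < (Finset.univ.filter fun a => Λ s a ≠ 0).card) (u : Tensor ℂ m) :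
    coMult u Λ d ≤ coMult (padMM ℂ n m h) Λ d := by
  rw [coMult_eq_finrank_of_le (hwvSpace_le_orbitVanishing_padMM_of_lt_card h Λ d hs)]
  exact coMult_le_finrank_hwvSpace u Λ d

end PointwiseSaturation

end Summit.MatrixMultiplication.MatrixMultiplication.Theorems.ObstructionCalculus

end
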